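/-
Copyright (c) 2026 the pub-hodgecm-mathlib formalisation cell (harness21).  Prover seat hodgecm-mathlib-K2E4-p10 (g9), Track B «K2-LIT»,
#184♮ = hLiu418 = `stmt-HodgeConjecture-24832`; socket #41, KIND W, (x-b) of LEAD F0P6-plan (g14) BATCH #62 (1) + desk K2E5-p17 RULING 2026-09-04T22:32:19Z
(«(β): per-place presentation; local → global is (x-b)'s genre; the consumer writes the socket»).  FILE 3, STAGE 2 of this seat's (x-b) chain: the PRESENTATION
ASSEMBLY — per-term letters on (x-a)'s `Σ ∏` presentation of the continued `T`-part ⟹ the two global letters (S-loc), (D-loc) of STAGE 1.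
THEOREMS ONLY (no `def`, no `instance`, no notation, no named-fact hypothesis, no `sorry`).
-/
import Summits.HodgeConjecture.HodgeConjecture.Theorems.K2LiuSiegelEisensteinKindWInstance   -- ★ p862446 (this seat): §1 `hsupp_of_local`, `two_le_absNorm`
import Literature.NumberTheory.Automorphic.UnitaryGroupAutomorphicRep                        -- ★ `UnitaryGroup.PlacesOver`
import Mathlib.NumberTheory.NumberField.InfinitePlace.Basic
import HarnessLib

/-!
# Crux `HLiu418`, socket #41, KIND W — `K2LiuSiegelEisensteinKindWPresentation`: THE PRESENTATION ASSEMBLY (STAGE 2) —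
# per-term arch ∕ finite letters on `A = Σ_j (∏_σ F_{∞,σ,j}) · (∏_{v ∈ T(S,h)} F_{v,j})` ⟹ the global support letter (S-loc) and the global decay letter (D-loc)

Cell `hodgecm-mathlib`, crux item hLiu418 = `stmt-HodgeConjecture-24832` (helper lane `--supports … --as helper`, count-neutral), route of record `HCCMUnconditional`;
squad K2 ∕ K2Liu, road `K2_Liu`, socket #41 `sig_K2LiuSiegelEisensteinContinuation`, KIND W.  STAGE 1 (★∕📤 `K2LiuSiegelEisensteinKindWPackage.exists_kindW_letters_of_globalLetters`)
turns the Euler data `(A, U, hEuler, hAd)` + `hdet0` + the two GLOBAL letters **(S-loc)** (the `hloc` of ★ `hsupp_of_local`) and **(D-loc)** (the `hloc` of ★ `hdec_of_letters`) into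
the TOP's KIND-W block.  (x-a) (F0P2-p08 (g2), ★ `K2LiuSiegelEisensteinKindWLetters` ed. 1–2: `kindWFinset`, `kindWPart`, §4 `whittakerDelta_eq_sum_mul_prod_mul`; ed. 3
`exists_kindW_eulerLetters`) PRESENTS the continued `T`-part as a finite sum over the `K`-finite index `j ∈ J(S,h)` of (archimedean product over the block places `σ`) ×
(finite product over the exceptional places `v ∈ T(S,h)`), `A := 0` at `det S = 0`.  THIS FILE is the generic assembly «per-term letters ⟹ (S-loc) ∧ (D-loc)»
(index type `ι`, read `skewMatrices …` with `mat := (↑)`; point type `X`, read `HA …` with `ht := (↑)`, `N := n + n`; places `v` of `L⁺ = Fp L` for the presentation,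
places `w` of `L` — `w ∣ v` through ★ `UnitaryGroup.PlacesOver` — for the lattice letters, as ★ `hsupp_of_local` wants):
* §1 `one_le_pow_absNorm_mul_pow_localHeight`, `exists_latticeLetter_of_integral` — the trivial lattice letter `m = 0` at an integral place;
* §2 **`sloc_of_presentation`** — (S-loc) from: the presentation `hpres`, `hdet0`, the PER-PLACE SUPPORT letters `hfsupp` («`F_{v,j} S s h ≠ 0` ⇒ at every `w ∣ v` a lattice
  letter `N(𝔭_w)^m ≤ N(𝔭_w)^{δ_w} H_w(h)^k ∧ |S_{ab}|_w ≤ q_w^m`», ★ Φ5 F4a per place) and integrality off `T(S,h)` (`hoff` = ★ `integral_of_not_mem_kindWPlaces`): a non-zero sum has a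
  non-zero term, whose finite factors are all non-zero;
* §3 **`dloc_of_presentation`** — (D-loc) from: `hpres`, `hdet0`, a bound `#J(S,h) ≤ N_J`, the ARCH letter per term in the global-arch currency
  `‖∏_σ F_{∞,σ,j}‖ ≤ C₁ ‖h‖^{a₁} (e^{−c ‖h‖^{−a′} τ} (1+τ)^{N₁}) ∏_{w∣∞}(1+|det S|_w⁻¹)^{N′}` (= ★ `K2LiuSiegelEisensteinKindWArchDecay` faces + ★ G7-C `detFactor_le_height` after the
  block → place dictionary, LH4-p08's `K2LiuSiegelEisensteinKindWArchBlock`), the FINITE letter per term in the global-finite currency `‖∏_{v∈T} F_{v,j}‖ ≤ C₂ ‖h‖^{a₂} (1+τ)^{N₂} D(S)^{N₃}`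
  (`D(S)` the LEAST denominator of `S`, product formula at the finite places), and (S-loc) itself (whence `D(S) ≤ C_W ‖h‖^κ` by ★ `hsupp_of_local` when `A ≠ 0`);
(§2's output is STAGE 1's `hSloc` binder verbatim and feeds §3; §3's output is STAGE 1's `hDloc` binder with `N₁ := N₁ + N₂`.)
[MoeglinWaldspurger1995, II.1.7, IV.1.9], [KudlaRallis1994, §1–§2], [Tan1999, §2–§4], [Shimura1997, §18.4 Prop. 18.14], [BorelJacquet1979, §1.2].
HONEST LABEL.  Count-neutral helper, closes no socket: `HC_CM` is proved only modulo the 7 printed citations (2 remaining named inputs: hLiu418 =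
`stmt-HodgeConjecture-24832`, h413 = `stmt-HodgeConjecture-24833`) until rung 0 closes.
-/

set_option autoImplicit false
set_option linter.dupNamespace false -- the mandated namespace repeats `HodgeConjecture.HodgeConjecture`

noncomputable section

namespace Summit.HodgeConjecture.HodgeConjecture.Cruxes.HLiu418.K2LiuSiegelEisensteinKindWPresentation

open scoped BigOperators NNReal
-- `Classical` is needed to see the Mathlib normed-ring instances on `mixedSpace L` (note H5 of ★ `AdelicGLnGlue`)
open scoped Classical
open NumberField NumberField.InfinitePlace IsDedekindDomain
open Literature.NumberTheory.Automorphic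
open Summit.HodgeConjecture.HodgeConjecture.Cruxes.HLiu418.K2LiuSiegelEisensteinKindWInstance (hsupp_of_local two_le_absNorm)

variable (L : Type) [Field L] [NumberField L]

/-! ## §1 The trivial lattice letter at an integral place -/

section Trivial

variable {N : ℕ} [NeZero N]

/-- `1 ≤ N(𝔭_w)^δ · H_w(g)^k` (`N(𝔭_w) ≥ 2`, `H_w ≥ 1`). [cite: BorelJacquet1979, §1.2] -/
theorem one_le_pow_absNorm_mul_pow_localHeight (w : HeightOneSpectrum (𝓞 L)) (g : GL (Fin N) (AdeleRing (𝓞 L) L)) (δ k : ℕ) :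
    (1 : ℝ) ≤ ((Ideal.absNorm w.asIdeal : ℕ) : ℝ) ^ δ * (GLn.localHeight N L w g : ℝ) ^ k := by
  have h2 : (1 : ℝ) ≤ ((Ideal.absNorm w.asIdeal : ℕ) : ℝ) := by
    have := two_le_absNorm L w
    exact_mod_cast (show 1 ≤ Ideal.absNorm w.asIdeal by omega)
  have hH : (1 : ℝ) ≤ (GLn.localHeight N L w g : ℝ) := by exact_mod_cast GLn.one_le_localHeight w g
  exact one_le_mul_of_one_le_of_one_le (one_le_pow₀ h2) (one_le_pow₀ hH)

/-- **the trivial lattice letter at an integral place**: if every entry of `S` is integral at `w` then `m = 0` serves (`|S_{ab}|_w ≤ 1 = q_w^0`,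
`N(𝔭_w)^0 = 1 ≤ N(𝔭_w)^{δ_w} H_w^k`). [cite: NeukirchANT1999, Ch. II §3] -/
theorem exists_latticeLetter_of_integral {n : ℕ} (S : Matrix (Fin n) (Fin n) L) (g : GL (Fin N) (AdeleRing (𝓞 L) L)) (w : HeightOneSpectrum (𝓞 L)) (δ k : ℕ)
    (hS : ∀ a b, ((S a b : L) : w.adicCompletion L) ∈ w.adicCompletionIntegers L) :
    ∃ m : ℕ, ((Ideal.absNorm w.asIdeal : ℕ) : ℝ) ^ m ≤ ((Ideal.absNorm w.asIdeal : ℕ) : ℝ) ^ δ * (GLn.localHeight N L w g : ℝ) ^ k ∧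
      ∀ a b, Valued.v (((S a b : L)) : w.adicCompletion L) ≤ WithZero.exp ((m : ℕ) : ℤ) := by
  refine ⟨0, by rw [pow_zero]; exact one_le_pow_absNorm_mul_pow_localHeight L w g δ k, fun a b => ?_⟩
  rw [Nat.cast_zero, WithZero.exp_zero]
  exact (HeightOneSpectrum.mem_adicCompletionIntegers (𝓞 L) L w).1 (hS a b)

end Trivial

/-! ## §2 (S-loc) from the presentation and the per-place support letters -/

section Sloc

variable {N : ℕ} [NeZero N] {n : ℕ}

/-- **(S-loc) FROM THE PRESENTATION.**  `A i s x = Σ_{j ∈ J i x} (∏_σ F_{∞,σ,j}) · ∏_{v ∈ T i x} F_{v,j}` for `det (mat i) ≠ 0`, `0 < re s` (`hpres`); `A = 0` at `det = 0`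
(`hdet0`); per-place SUPPORT letters at the places of the presentation (`hfsupp`: `F_{v,j} i s x ≠ 0` forces a lattice letter at every `w ∣ v`); integrality of the entries of
`mat i` above the places off `T i x` (`hoff`).  THEN the global lattice letter of ★ `hsupp_of_local`:
`A i s x ≠ 0 ⇒ ∀ w, ∃ m, N(𝔭_w)^m ≤ N(𝔭_w)^{δ_w} H_w(ht x)^k ∧ |mat i|_w ≤ q_w^m` (a non-zero sum has a non-zero term, all of whose finite factors are non-zero; at `w ∣ v`
with `v ∈ T` the letter of `F_{v,j}`, else the trivial letter §1). [cite: Shimura1997, §18.4 Prop. 18.14] [cite: KudlaRallis1994, §2] [cite: MoeglinWaldspurger1995, II.1.7] -/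
theorem sloc_of_presentation {ι X κT Sinf : Type*} [Fintype Sinf]
    (mat : ι → Matrix (Fin n) (Fin n) L) (ht : X → GL (Fin N) (AdeleRing (𝓞 L) L)) (A : ι → ℂ → X → ℂ)
    (hdet0 : ∀ (i : ι) (s : ℂ) (x : X), (mat i).det = 0 → A i s x = 0)
    (J : ι → X → Finset κT) (Tfin : ι → X → Finset (HeightOneSpectrum (𝓞 ↥(maximalRealSubfield L))))
    (Finf : Sinf → κT → ι → ℂ → X → ℂ) (Ffin : HeightOneSpectrum (𝓞 ↥(maximalRealSubfield L)) → κT → ι → ℂ → X → ℂ)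
    (hpres : ∀ (i : ι) (s : ℂ) (x : X), (mat i).det ≠ 0 → 0 < s.re →
      A i s x = ∑ j ∈ J i x, (∏ σ, Finf σ j i s x) * ∏ v ∈ Tfin i x, Ffin v j i s x)
    (δ : HeightOneSpectrum (𝓞 L) → ℕ) (k : ℕ)
    (hfsupp : ∀ (v : HeightOneSpectrum (𝓞 ↥(maximalRealSubfield L))) (j : κT) (i : ι) (s : ℂ) (x : X), v ∈ Tfin i x → 0 < s.re → Ffin v j i s x ≠ 0 →
      ∀ w : UnitaryGroup.PlacesOver L v, ∃ m : ℕ,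
        ((Ideal.absNorm w.1.asIdeal : ℕ) : ℝ) ^ m ≤ ((Ideal.absNorm w.1.asIdeal : ℕ) : ℝ) ^ δ w.1 * (GLn.localHeight N L w.1 (ht x) : ℝ) ^ k ∧
          ∀ a b, Valued.v (((mat i a b : L)) : w.1.adicCompletion L) ≤ WithZero.exp (m : ℤ))
    (hoff : ∀ (i : ι) (x : X) (v : HeightOneSpectrum (𝓞 ↥(maximalRealSubfield L))), v ∉ Tfin i x → ∀ (w : UnitaryGroup.PlacesOver L v) (a b : Fin n),
      ((mat i a b : L) : w.1.adicCompletion L) ∈ w.1.adicCompletionIntegers L) :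
    ∀ (i : ι) (s : ℂ) (x : X), 0 < s.re → A i s x ≠ 0 → ∀ w : HeightOneSpectrum (𝓞 L), ∃ m : ℕ,
      ((Ideal.absNorm w.asIdeal : ℕ) : ℝ) ^ m ≤ ((Ideal.absNorm w.asIdeal : ℕ) : ℝ) ^ δ w * (GLn.localHeight N L w (ht x) : ℝ) ^ k ∧
        ∀ a b, Valued.v (((mat i a b : L)) : w.adicCompletion L) ≤ WithZero.exp (m : ℤ) := by
  intro i s x hs hA w
  have hdet : (mat i).det ≠ 0 := fun h => hA (hdet0 i s x h)
  rw [hpres i s x hdet hs] at hA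
  obtain ⟨j, hj, hterm⟩ := Finset.exists_ne_zero_of_sum_ne_zero hA
  have hfin : ∀ v ∈ Tfin i x, Ffin v j i s x ≠ 0 := Finset.prod_ne_zero_iff.1 (right_ne_zero_of_mul hterm)
  -- the place `v` of `L⁺` under `w`
  set v : HeightOneSpectrum (𝓞 ↥(maximalRealSubfield L)) := w.under (𝓞 ↥(maximalRealSubfield L)) with hv
  have hw : (⟨w, rfl⟩ : UnitaryGroup.PlacesOver L v).1 = w := rfl
  by_cases hvT : v ∈ Tfin i x
  · exact hfsupp v j i s x hvT hs (hfin v hvT) ⟨w, rfl⟩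
  · exact exists_latticeLetter_of_integral L (mat i) (ht x) w (δ w) k fun a b => hoff i x v hvT ⟨w, rfl⟩ a b

end Sloc

/-! ## §3 (D-loc) from the presentation, the per-term arch ∕ finite letters and the least denominator -/

section Dloc

-- `Classical` as above; the TOP's size letter `τ i = ‖(ι_∞ (mat i)_{ab})_{ab}‖` enters only through `0 ≤ τ i`
variable {N : ℕ} [NeZero N] {n : ℕ}

/-- **(D-loc) FROM THE PRESENTATION.**  With the presentation `hpres` ∕ `hdet0`, a uniform bound `#J i x ≤ N_J` on the `K`-finite index, the support letter (S-loc) (§2) with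
its defect datum `(T_δ, δ, k)` (`δ = 0` off `T_δ`), the LEAST denominator `D i` of `mat i` (`hD1`, `hDint`, `hDmin`), and PER-TERM size letters, locally uniformly in `s`:
ARCH `‖∏_σ F_{∞,σ,j} i s x‖ ≤ C ‖x‖^a · (e^{−c ‖x‖^{−a′} τ i} (1 + τ i)^{N₁}) · ∏_{w∣∞} (1 + |det(mat i)|_w⁻¹)^{N′}` and FINITE `‖∏_{v∈T} F_{v,j} i s x‖ ≤ C ‖x‖^a (1 + τ i)^{N₂} (D i)^{N₃}`
— THEN the global decay letter of ★ `hdec_of_letters`: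
`∀ z, 0 < re z → ∃ C a c a′ r, … ∀ i s, dist s z < r → ∀ x, ‖A i s x‖ ≤ C ‖x‖^a (e^{−c ‖x‖^{−a′} τ i} (1+τ i)^{N₁+N₂}) ∏_{w∣∞}(1+|det(mat i)|_w⁻¹)^{N′}`
(sum of `≤ N_J` products; `D i ≤ C_W ‖x‖^κ` by ★ `hsupp_of_local` whenever `A i s x ≠ 0`, `r ↦ min r (re z)`).
[cite: MoeglinWaldspurger1995, II.1.7, IV.1.9] [cite: Tan1999, §4 Prop. 4.8] [cite: Shimura1997, §18.4 Prop. 18.14] [cite: BorelJacquet1979, §1.2] -/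
theorem dloc_of_presentation {ι X κT Sinf : Type*} [Fintype Sinf]
    (mat : ι → Matrix (Fin n) (Fin n) L) (ht : X → GL (Fin N) (AdeleRing (𝓞 L) L)) (A : ι → ℂ → X → ℂ) (τ : ι → ℝ) (hτ0 : ∀ i, 0 ≤ τ i)
    (hdet0 : ∀ (i : ι) (s : ℂ) (x : X), (mat i).det = 0 → A i s x = 0)
    (J : ι → X → Finset κT) (NJ : ℕ) (hJ : ∀ i x, (J i x).card ≤ NJ) (Tfin : ι → X → Finset (HeightOneSpectrum (𝓞 ↥(maximalRealSubfield L))))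
    (Finf : Sinf → κT → ι → ℂ → X → ℂ) (Ffin : HeightOneSpectrum (𝓞 ↥(maximalRealSubfield L)) → κT → ι → ℂ → X → ℂ)
    (hpres : ∀ (i : ι) (s : ℂ) (x : X), (mat i).det ≠ 0 → 0 < s.re →
      A i s x = ∑ j ∈ J i x, (∏ σ, Finf σ j i s x) * ∏ v ∈ Tfin i x, Ffin v j i s x)
    -- (S-loc) (§2) with its defect datum
    (Tδ : Finset (HeightOneSpectrum (𝓞 L))) (δ : HeightOneSpectrum (𝓞 L) → ℕ) (hδ : ∀ w ∉ Tδ, δ w = 0) (k : ℕ)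
    (hSloc : ∀ (i : ι) (s : ℂ) (x : X), 0 < s.re → A i s x ≠ 0 → ∀ w : HeightOneSpectrum (𝓞 L), ∃ m : ℕ,
      ((Ideal.absNorm w.asIdeal : ℕ) : ℝ) ^ m ≤ ((Ideal.absNorm w.asIdeal : ℕ) : ℝ) ^ δ w * (GLn.localHeight N L w (ht x) : ℝ) ^ k ∧
        ∀ a b, Valued.v (((mat i a b : L)) : w.adicCompletion L) ≤ WithZero.exp (m : ℤ))
    -- the least denominator of `mat i`
    (D : ι → ℕ) (hDmin : ∀ (i : ι) (D' : ℕ), 1 ≤ D' → (∀ a b, IsIntegral ℤ ((D' : L) * mat i a b)) → D i ≤ D')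
    -- the per-term size letters
    (N₁ N' N₂ N₃ : ℕ)
    (harch : ∀ z : ℂ, 0 < z.re → ∃ C a c a' r : ℝ, 0 ≤ C ∧ 0 ≤ a ∧ 0 < c ∧ 0 ≤ a' ∧ 0 < r ∧ ∀ (j : κT) (i : ι) (s : ℂ), dist s z < r → ∀ x : X,
      ‖∏ σ, Finf σ j i s x‖ ≤ C * adelicHeightGL N L (ht x) ^ a *
        (Real.exp (-(c * adelicHeightGL N L (ht x) ^ (-a') * τ i)) * (1 + τ i) ^ N₁) * ∏ w : InfinitePlace L, (1 + (w (mat i).det)⁻¹) ^ N')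
    (hfsize : ∀ z : ℂ, 0 < z.re → ∃ C a r : ℝ, 0 ≤ C ∧ 0 ≤ a ∧ 0 < r ∧ ∀ (j : κT) (i : ι) (s : ℂ), dist s z < r → ∀ x : X,
      ‖∏ v ∈ Tfin i x, Ffin v j i s x‖ ≤ C * adelicHeightGL N L (ht x) ^ a * (1 + τ i) ^ N₂ * (D i : ℝ) ^ N₃) :
    ∀ z : ℂ, 0 < z.re → ∃ C a c a' r : ℝ, 0 ≤ C ∧ 0 ≤ a ∧ 0 < c ∧ 0 ≤ a' ∧ 0 < r ∧ ∀ (i : ι) (s : ℂ), dist s z < r → ∀ x : X,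
      ‖A i s x‖ ≤ C * adelicHeightGL N L (ht x) ^ a *
        (Real.exp (-(c * adelicHeightGL N L (ht x) ^ (-a') * τ i)) * (1 + τ i) ^ (N₁ + N₂)) * ∏ w : InfinitePlace L, (1 + (w (mat i).det)⁻¹) ^ N' := by
  -- the support letter as a denominator bound (★ `hsupp_of_local`)
  obtain ⟨CW, κ, hCW, hκ, hsupp⟩ := hsupp_of_local L mat ht A Tδ δ hδ k hSloc
  intro z hz
  obtain ⟨C₁, a₁, c, a', r₁, hC₁, ha₁, hc, ha', hr₁, hb₁⟩ := harch z hz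
  obtain ⟨C₂, a₂, r₂, hC₂, ha₂, hr₂, hb₂⟩ := hfsize z hz
  refine ⟨NJ * (C₁ * C₂ * CW ^ N₃), a₁ + a₂ + κ * N₃, c, a', min (min r₁ r₂) z.re, by positivity, by positivity, hc, ha',
    lt_min (lt_min hr₁ hr₂) hz, fun i s hs x => ?_⟩
  have hs₁ : dist s z < r₁ := lt_of_lt_of_le hs ((min_le_left _ _).trans (min_le_left _ _))
  have hs₂ : dist s z < r₂ := lt_of_lt_of_le hs ((min_le_left _ _).trans (min_le_right _ _))
  have hs0 : 0 < s.re := by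
    have h1 : dist s z < z.re := lt_of_lt_of_le hs (min_le_right _ _)
    have h2 : |s.re - z.re| ≤ dist s z := by
      rw [Complex.dist_eq, ← Complex.sub_re]
      exact Complex.abs_re_le_norm (s - z)
    have h3 := (abs_lt.1 (lt_of_le_of_lt h2 h1)).1
    linarith
  set H : ℝ := adelicHeightGL N L (ht x) with hH
  have hHpos : 0 < H := adelicHeightGL_pos_holds (ht x)
  set E : ℝ := Real.exp (-(c * H ^ (-a') * τ i)) with hE
  have hE0 : 0 < E := Real.exp_pos _
  set Df : ℝ := ∏ w : InfinitePlace L, (1 + (w (mat i).det)⁻¹) ^ N' with hDf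
  have hDf0 : 0 ≤ Df := Finset.prod_nonneg fun w _ => pow_nonneg (add_nonneg zero_le_one (inv_nonneg.2 (apply_nonneg _ _))) _
  have hτi := hτ0 i
  -- the right-hand side is non-negative
  have hRHS0 : 0 ≤ NJ * (C₁ * C₂ * CW ^ N₃) * H ^ (a₁ + a₂ + κ * N₃) * (E * (1 + τ i) ^ (N₁ + N₂)) * Df := by positivity
  by_cases hA : A i s x = 0
  · rw [hA, norm_zero]; exact hRHS0
  have hdet : (mat i).det ≠ 0 := fun h => hA (hdet0 i s x h)
  -- the denominator against the height
  obtain ⟨D', hD'1, hD'le, hD'int⟩ := hsupp i s x hs0 hA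
  have hDle : (D i : ℝ) ≤ CW * H ^ κ := le_trans (by exact_mod_cast hDmin i D' hD'1 hD'int) hD'le
  have hD0 : (0 : ℝ) ≤ D i := Nat.cast_nonneg _
  have hDpow : (D i : ℝ) ^ N₃ ≤ CW ^ N₃ * H ^ (κ * N₃) := by
    calc (D i : ℝ) ^ N₃ ≤ (CW * H ^ κ) ^ N₃ := pow_le_pow_left₀ hD0 hDle N₃
      _ = CW ^ N₃ * H ^ (κ * N₃) := by rw [mul_pow, ← Real.rpow_natCast (H ^ κ), ← Real.rpow_mul hHpos.le]
  -- the term-wise bound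
  have hterm : ∀ j ∈ J i x, ‖(∏ σ, Finf σ j i s x) * ∏ v ∈ Tfin i x, Ffin v j i s x‖ ≤
      (C₁ * C₂ * CW ^ N₃) * H ^ (a₁ + a₂ + κ * N₃) * (E * (1 + τ i) ^ (N₁ + N₂)) * Df := by
    intro j _
    rw [norm_mul]
    have h₁ := hb₁ j i s hs₁ x
    have h₂ := hb₂ j i s hs₂ x
    have h₁0 : 0 ≤ C₁ * H ^ a₁ * (E * (1 + τ i) ^ N₁) * Df := by positivity
    calc ‖∏ σ, Finf σ j i s x‖ * ‖∏ v ∈ Tfin i x, Ffin v j i s x‖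
        ≤ (C₁ * H ^ a₁ * (E * (1 + τ i) ^ N₁) * Df) * (C₂ * H ^ a₂ * (1 + τ i) ^ N₂ * (D i : ℝ) ^ N₃) :=
          mul_le_mul h₁ h₂ (norm_nonneg _) h₁0
      _ ≤ (C₁ * H ^ a₁ * (E * (1 + τ i) ^ N₁) * Df) * (C₂ * H ^ a₂ * (1 + τ i) ^ N₂ * (CW ^ N₃ * H ^ (κ * N₃))) :=
          mul_le_mul_of_nonneg_left (mul_le_mul_of_nonneg_left hDpow (by positivity)) h₁0
      _ = (C₁ * C₂ * CW ^ N₃) * (H ^ a₁ * H ^ a₂ * H ^ (κ * N₃)) * (E * ((1 + τ i) ^ N₁ * (1 + τ i) ^ N₂)) * Df := by ring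
      _ = (C₁ * C₂ * CW ^ N₃) * H ^ (a₁ + a₂ + κ * N₃) * (E * (1 + τ i) ^ (N₁ + N₂)) * Df := by
          rw [← Real.rpow_add hHpos, ← Real.rpow_add hHpos, ← pow_add]
  -- sum over the `K`-finite index
  rw [hpres i s x hdet hs0]
  calc ‖∑ j ∈ J i x, (∏ σ, Finf σ j i s x) * ∏ v ∈ Tfin i x, Ffin v j i s x‖
      ≤ ∑ j ∈ J i x, ‖(∏ σ, Finf σ j i s x) * ∏ v ∈ Tfin i x, Ffin v j i s x‖ := norm_sum_le _ _
    _ ≤ ∑ _j ∈ J i x, (C₁ * C₂ * CW ^ N₃) * H ^ (a₁ + a₂ + κ * N₃) * (E * (1 + τ i) ^ (N₁ + N₂)) * Df := Finset.sum_le_sum hterm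
    _ = (J i x).card * ((C₁ * C₂ * CW ^ N₃) * H ^ (a₁ + a₂ + κ * N₃) * (E * (1 + τ i) ^ (N₁ + N₂)) * Df) := by
        rw [Finset.sum_const, nsmul_eq_mul]
    _ ≤ NJ * ((C₁ * C₂ * CW ^ N₃) * H ^ (a₁ + a₂ + κ * N₃) * (E * (1 + τ i) ^ (N₁ + N₂)) * Df) :=
        mul_le_mul_of_nonneg_right (by exact_mod_cast hJ i x) (by positivity)
    _ = NJ * (C₁ * C₂ * CW ^ N₃) * H ^ (a₁ + a₂ + κ * N₃) * (E * (1 + τ i) ^ (N₁ + N₂)) * Df := by ring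

end Dloc

end Summit.HodgeConjecture.HodgeConjecture.Cruxes.HLiu418.K2LiuSiegelEisensteinKindWPresentation

end
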